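import Summits.HubbardSuperconductivity.HubbardSuperconductivity.Theorems.AnisotropyChordTransferFibre3FinXBCover

/-!
# Route `AnisotropyChord` / H0 rotor rung: FIN exact-block row-`N₁` certificate at `L = 12` — cell facts, part `f`

Kernel facts `xbCellAny 12 (49/50) la lb c = true` (`decide +kernel`, zero data) for 9 λ-cells of the per-`L` cover
(`…FinXBCover.xbCheck`; cell design: p3 g5 scratch `xb_design.py`, float mirror `xb_mirror.py`); assembled in `…FinXBTwelve`.
Prover seat `hubbard-h0-rotor-p3` g5; helper for piece A = stmt-HubbardSuperconductivity-23918 of rung 19089 (`--supports`, helper class).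
WHAT THIS IS NOT: nothing here proves superconductivity in the Hubbard model (rotor TARGET as worded stays FALSE, g15 verdict); kernel facts for the FIN certificate of ONE hypothesis (row `N₁`) of ONE conditional reduction.  Tree imports only; no sorry, no new axioms.
-/

namespace Summit.HubbardSuperconductivity.HubbardSuperconductivity.Theorems.AnisotropyChord.Transfer.Fibre3

namespace FinXB

set_option maxHeartbeats 4000000 in
/-- kernel fact: cell 58 at `L = 12` (certified, c = (9/20 : ℚ)). [folklore] -/
theorem xb12_58 : xbCellAny 12 (49/50 : ℚ) 4952817721240434 5249986784514861 (9/20 : ℚ) = true := by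
  decide +kernel

set_option maxHeartbeats 4000000 in
/-- kernel fact: cell 59 at `L = 12` (certified, c = (9/20 : ℚ)). [folklore] -/
theorem xb12_59 : xbCellAny 12 (49/50 : ℚ) 5249986784514861 5564985991585754 (9/20 : ℚ) = true := by
  decide +kernel

set_option maxHeartbeats 4000000 in
/-- kernel fact: cell 60 at `L = 12` (certified, c = (9/20 : ℚ)). [folklore] -/
theorem xb12_60 : xbCellAny 12 (49/50 : ℚ) 5564985991585754 5898885151080901 (9/20 : ℚ) = true := by
  decide +kernel

set_option maxHeartbeats 4000000 in
/-- kernel fact: cell 61 at `L = 12` (certified, c = (9/20 : ℚ)). [folklore] -/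
theorem xb12_61 : xbCellAny 12 (49/50 : ℚ) 5898885151080901 6252818260145756 (9/20 : ℚ) = true := by
  decide +kernel

set_option maxHeartbeats 4000000 in
/-- kernel fact: cell 62 at `L = 12` (certified, c = (9/20 : ℚ)). [folklore] -/
theorem xb12_62 : xbCellAny 12 (49/50 : ℚ) 6252818260145756 6627987355754503 (9/20 : ℚ) = true := by
  decide +kernel

set_option maxHeartbeats 4000000 in
/-- kernel fact: cell 63 at `L = 12` (certified, c = (9/20 : ℚ)). [folklore] -/
theorem xb12_63 : xbCellAny 12 (49/50 : ℚ) 6627987355754503 7025666597099775 (9/20 : ℚ) = true := by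
  decide +kernel

set_option maxHeartbeats 4000000 in
/-- kernel fact: cell 64 at `L = 12` (certified, c = (9/20 : ℚ)). [folklore] -/
theorem xb12_64 : xbCellAny 12 (49/50 : ℚ) 7025666597099775 7447206592925763 (9/20 : ℚ) = true := by
  decide +kernel

set_option maxHeartbeats 4000000 in
/-- kernel fact: cell 65 at `L = 12` (certified, c = (9/20 : ℚ)). [folklore] -/
theorem xb12_65 : xbCellAny 12 (49/50 : ℚ) 7447206592925763 7894038988501310 (9/20 : ℚ) = true := by
  decide +kernel

set_option maxHeartbeats 4000000 in
/-- kernel fact: cell 66 at `L = 12` (certified, c = (9/20 : ℚ)). [folklore] -/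
theorem xb12_66 : xbCellAny 12 (49/50 : ℚ) 7894038988501310 8367681327811390 (9/20 : ℚ) = true := by
  decide +kernel

end FinXB

end Summit.HubbardSuperconductivity.HubbardSuperconductivity.Theorems.AnisotropyChord.Transfer.Fibre3
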